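import Summits.QuantumFields.YangMills.Theorems.BalabanUVNodesN11PartCompatOfCouplings

/-!
# DAG node N11 — LOCATED: THE TOP-LEVEL ROOM at K1's witness of record `θ₁₅ᶜᶜᴹᵂ(j; γ)` — the run guard `PartCompat₁₃ … K` (dag-n11-w4's `…PartCompatOfCouplings`:
# `log g_K⁻² ≤ L^{m−j}`) and the numeric row `h3` at level `K` (`3·side ≤ cubeSide`, which at `M₁ = L^j`, `M₂ = r = 1` forces `R_K ≥ L^j`, i.e. `log g_K⁻² > L^{j−1}`)
# are JOINTLY satisfiable on a windowed full-length run only if `2j ≤ F.m` (sharper than the guard's own `j + 1 ≤ F.m`; count-neutral, nothing registered is denied)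

HEADER — WORK-UNIT METADATA.  Cell `pub-ymgap`, YM-PLAN Track A (HUMAN RULING D-0062 ∕ D-0149 width seats), seat `pub-ymgap-dag-n11-w3` (g3; WIDTH SEAT 3∕4 on NODE n11 [B14],
director-ym №197), route `BalabanUVNodes` (v1.7 `CoPH` key), item K1⁷ `StabilityBAtRecordR13SepCoPH` = stmt-QuantumFields-20542 (helper lane `--kind proof --supports 20542
--as helper`, count-neutral).  Sequel of this seat's p608030 `…N11NoExpansionNumericsAtThm1CCMW` (the five numeric rows at `θ₁₅ᶜᶜᴹᵂ(j; γ)` are a matter of the window letter) read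
against dag-n11-w4 g3's `…N11PartCompatOfCouplings` (`partCompat₁₃_theta13OfThm1CCMW_iff`: the run guard IS `∀ 1 ≤ i ≤ n, log g_i⁻² ≤ L^{m+K−i−j}`; `room_lt_of_partCompat₁₃_…_of_window`:
`n + j + 1 ≤ m + K`) and dag-n21-c's `B15Claim189N0OfRecord.RkOfRecord_le_pow_of_le` (minimality in (2.5)).  [III] = [Balaban1988Convergent], [I] = [Balaban1987RG1].

WHY THIS FILE.  dag-n11-d's SAME-WITNESS face (p605244 ∕ its `_of_nesting` ∕ `_of_scalars` editions) reads at the child level `k + 1` BOTH the run guard `PartCompat₁₃ … (k+1)` and the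
numeric rows at the levels `≤ k + 1`; at the last step `k + 1 = K` of a full-length run at `θ₁₅ᶜᶜᴹᵂ(j; γ)` the guard caps `log g_K⁻²` by `L^{m−j}` FROM ABOVE while the row `h3` (three
(2.13)-boxes of side `L^K·M₁ = L^{K+j}` inside a `χ`-cube of side `L^{K+1}·M₂·R_K = L^{K+1}·R_K`) needs `R_K ≥ 3L^{j−1}`, i.e. (`R_K = L^s` minimal over `log g_K⁻²`) `log g_K⁻² > L^{j−1}`
FROM BELOW.  Both at once: `L^{j−1} < L^{m−j}`, i.e. **`2j ≤ F.m`**.  With `j ≥ 1` forced by the cube cover (`L·M₂ ∣ M = L^j`, dag-n11-w4 p606678), the K0-rows road at the witness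
of record needs `F.m ≥ 2j ≥ 2`; K1⁷ quantifies over ALL families (`T4Family.hm : 1 ≤ m`).  Whether the plan answers by a volume floor, by `j`-dependence of the last step, or by asking
the guard only where print needs it, is the plan's ∕ node00-def-T's word — this file asserts only the arithmetic.

WHAT THIS FILE PROVES (0 `def`, 0 `sorry`, standard axioms).  §1 (generic `L j i : ℕ`, `g : ℝ`): ★ `pow_lt_log_of_h3Row` — at the CCM shape the `h3` row at level `i` gives
`L^{j−1} < log g_i⁻²` (`R_i ≥ L^j` by minimality).  §2 at `θ₁₅ᶜᶜᴹᵂ(j; γ)`: ★★ `two_mul_le_m_of_h3Row_of_partCompat₁₃_top` (window `γ′ < e^{−1∕2}` up to `K ≥ 1`, `PartCompat₁₃ … K`, the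
`h3` row at level `K` ⇒ `2j ≤ F.m`) · ★★ `not_h3Row_top_of_partCompat₁₃_of_lt` (`F.m < 2j` ⇒ the `h3` row at level `K` FAILS on every compatible windowed full-length run) ·
`not_partCompat₁₃_top_of_h3Row_of_lt` (contrapositive reading: the row holds ⇒ the guard fails).

HONEST FRAMING.  Helper lane, count-neutral ℕ∕ℝ bookkeeping on displayed numerals (K0a ∕ dag-n21-c's `M₁ = M = L^j`, `M₂ = r = 1`); nothing of Bałaban asserted; NOT a refutation
of any registered text (K1⁷'s stub texts display neither row); it LOCATES which `(F, j)` can feed both displayed rows of the same-witness face at the top level.  N11 NOT discharged;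
K1⁷ NOT closed; counts unmoved (typed 28∕28 · discharged 5∕27).  One finite `𝕋⁴_{L^K}` programme at fixed `ε = L^{−K}`; R4 closes only the conditional finite-𝕋⁴ rung
`BalabanLadder.UV` — NOT ℝ⁴, NOT OS, NOT a mass gap, NOT Clay.  No `sorry`, no `axiom`, no `def`, no `instance`, no `notation`.
Sources (SHAPE only): [III] (2.1) p.254, (2.5) p.255, (2.13) pp.256–257, (2.17) p.257; [I] (0.1) p.251 (torus `2L^m∕ε`), Thm 1 p.259 (the window).
-/

noncomputable section

namespace Summit.QuantumFields.YangMills.Theorems.BalabanUVNodesN11TopLevelRoomAtThm1CCMW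

open Literature.MathematicalPhysics.QuantumFieldTheory.Balaban1983to89 T4Continuum Node00
open B14.Eq213MaximalDomains (side)
open B15Claim189N0OfRecord (RkOfRecord_le_pow_of_le)
open BalabanUVNodesN11PartCompatOfCouplings (partCompat₁₃_theta13OfThm1CCMW_iff room_lt_of_partCompat₁₃_theta13OfThm1CCMW_of_window)

/-! ## §1  The `h3` row at the CCM shape forces `log g⁻² > L^{j−1}` -/

section Generic

/-- **★ AT THE CCM SHAPE (`M₁ = L^j`, `M₂ = r = 1`) THE ROW `h3` AT LEVEL `i` FORCES `L^{j−1} < log g_i⁻²`**: the row reads `3·L^i·L^j ≤ L^{i+1}·R`, so `R ≥ 3L^{j−1} > L^{j−1}`,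
and `R = L^s` with `s` minimal over `log g⁻²` ((2.5); `RkOfRecord_le_pow_of_le`), so `log g⁻² ≤ L^{j−1}` would give `R ≤ L^{j−1}`.
[cite: Balaban1988Convergent, (2.5) p.255, (2.13) pp.256–257, (2.17) p.257 (bookkeeping on displayed numerals)] -/
theorem pow_lt_log_of_h3Row {L j i : ℕ} (hL : 2 ≤ L) (hj : 1 ≤ j) {g : ℝ}
    (h3 : 3 * side L (L ^ j) i ≤ cubeSide L 1 (RkOfRecord L 1 g) i) : ((L ^ (j - 1) : ℕ) : ℝ) < Real.log (g ^ 2)⁻¹ := by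
  by_contra hlt
  have hle := not_lt.mp hlt
  have hR : RkOfRecord L 1 g ≤ L ^ (j - 1) := RkOfRecord_le_pow_of_le hL 1 g (by rw [pow_one]; exact hle)
  unfold side cubeSide at h3
  have hle' : L ^ (i + 1) * 1 * RkOfRecord L 1 g ≤ L ^ i * L ^ j := by
    calc L ^ (i + 1) * 1 * RkOfRecord L 1 g ≤ L ^ (i + 1) * 1 * L ^ (j - 1) := Nat.mul_le_mul_left _ hR
      _ = L ^ (i + 1 + (j - 1)) := by rw [mul_one, ← pow_add]
      _ = L ^ i * L ^ j := by rw [← pow_add]; congr 1; omega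
  have hpos : 0 < L ^ i * L ^ j := by positivity
  set X := L ^ i * L ^ j with hX
  set Y := L ^ (i + 1) * 1 * RkOfRecord L 1 g with hY
  omega

end Generic

/-! ## §2  At K1's witness of record `θ₁₅ᶜᶜᴹᵂ(j; γ)`: guard at `K` ∧ row `h3` at `K` ⇒ `2j ≤ F.m` -/

section Witness

variable (F : T4Family) (N : ℕ) [NeZero N] (j : ℕ) (γ ε₀ ε₂₉ B₃ B₃' a₀ a₁ : ℝ)

/-- **★★ LOCATED — THE TOP-LEVEL ROOM**: on a run of length `K ≥ 1` whose couplings lie in a window `]0, γ′]`, `γ′ < e^{−1∕2}` (every K1 window), at `θ₁₅ᶜᶜᴹᵂ(j; γ)` with `j ≥ 1`: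
the run guard `PartCompat₁₃ … K` AND the numeric row `h3` at level `K` together force `2j ≤ F.m` (guard: `log g_K⁻² ≤ L^{m−j}`, dag-n11-w4; row: `L^{j−1} < log g_K⁻²`, §1).
Count-neutral; nothing registered is denied. [cite: Balaban1988Convergent, (2.1) p.254, (2.5) p.255, (2.13) pp.256–257, (2.17) p.257; Balaban1987RG1, (0.1) p.251, Thm 1 p.259] -/
theorem two_mul_le_m_of_h3Row_of_partCompat₁₃_top (p : B12.RunParams) (hK : 1 ≤ p.K) (hj : 1 ≤ j) {γ' : ℝ}
    (hw : Step.InInterval γ' p.K (gOfRecord₁₃ F N (theta13OfThm1CCMW F N j γ ε₀ ε₂₉ B₃ B₃' a₀ a₁) p)) (hγ : γ' < Real.exp (-(1 / 2)))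
    (hPC : PartCompat₁₃ F N (theta13OfThm1CCMW F N j γ ε₀ ε₂₉ B₃ B₃' a₀ a₁) p p.K)
    (h3 : 3 * side (F.P p.K).L (theta13OfThm1CCMW F N j γ ε₀ ε₂₉ B₃ B₃' a₀ a₁).ν.M₁ p.K ≤
      cubeSide (F.P p.K).L (theta13OfThm1CCMW F N j γ ε₀ ε₂₉ B₃ B₃' a₀ a₁).ν.M₂
        (RkOfRecord (F.P p.K).L (theta13OfThm1CCMW F N j γ ε₀ ε₂₉ B₃ B₃' a₀ a₁).ν.r (gOfRecord₁₃ F N (theta13OfThm1CCMW F N j γ ε₀ ε₂₉ B₃ B₃' a₀ a₁) p p.K)) p.K) :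
    2 * j ≤ F.m := by
  have hL1 : 1 < F.L := by have := F.hL11; omega
  have hroom := room_lt_of_partCompat₁₃_theta13OfThm1CCMW_of_window F N j γ ε₀ ε₂₉ B₃ B₃' a₀ a₁ p hK hw hγ hPC
  have hcap := (partCompat₁₃_theta13OfThm1CCMW_iff F N j γ ε₀ ε₂₉ B₃ B₃' a₀ a₁ p (n := p.K) (by omega)).1 hPC p.K hK le_rfl
  have h3' : 3 * side F.L (F.L ^ j) p.K ≤ cubeSide F.L 1 (RkOfRecord F.L 1 (gOfRecord₁₃ F N (theta13OfThm1CCMW F N j γ ε₀ ε₂₉ B₃ B₃' a₀ a₁) p p.K)) p.K := h3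
  have hlt := pow_lt_log_of_h3Row (by omega) hj h3'
  have hcast : ((F.L ^ (j - 1) : ℕ) : ℝ) < ((F.L ^ (F.m + p.K - p.K - j) : ℕ) : ℝ) := hlt.trans_le hcap
  have hnat : F.L ^ (j - 1) < F.L ^ (F.m + p.K - p.K - j) := by exact_mod_cast hcast
  have hexp := (Nat.pow_lt_pow_iff_right hL1).1 hnat
  omega

/-- **★★ `F.m < 2j` ⇒ ON EVERY COMPATIBLE WINDOWED FULL-LENGTH RUN THE ROW `h3` AT LEVEL `K` FAILS** at `θ₁₅ᶜᶜᴹᵂ(j; γ)` (contrapositive of the previous theorem): the same-witness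
face's displayed rows `hPC′` and `h3` at `k + 1 = K` are then not jointly inhabited.  Count-neutral. [cite: Balaban1988Convergent, (2.5) p.255, (2.13) pp.256–257, (2.17) p.257; Balaban1987RG1, (0.1) p.251] -/
theorem not_h3Row_top_of_partCompat₁₃_of_lt (p : B12.RunParams) (hK : 1 ≤ p.K) (hj : 1 ≤ j) (hm : F.m < 2 * j) {γ' : ℝ}
    (hw : Step.InInterval γ' p.K (gOfRecord₁₃ F N (theta13OfThm1CCMW F N j γ ε₀ ε₂₉ B₃ B₃' a₀ a₁) p)) (hγ : γ' < Real.exp (-(1 / 2)))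
    (hPC : PartCompat₁₃ F N (theta13OfThm1CCMW F N j γ ε₀ ε₂₉ B₃ B₃' a₀ a₁) p p.K) :
    ¬ 3 * side (F.P p.K).L (theta13OfThm1CCMW F N j γ ε₀ ε₂₉ B₃ B₃' a₀ a₁).ν.M₁ p.K ≤
      cubeSide (F.P p.K).L (theta13OfThm1CCMW F N j γ ε₀ ε₂₉ B₃ B₃' a₀ a₁).ν.M₂
        (RkOfRecord (F.P p.K).L (theta13OfThm1CCMW F N j γ ε₀ ε₂₉ B₃ B₃' a₀ a₁).ν.r (gOfRecord₁₃ F N (theta13OfThm1CCMW F N j γ ε₀ ε₂₉ B₃ B₃' a₀ a₁) p p.K)) p.K := fun h3 => by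
  have := two_mul_le_m_of_h3Row_of_partCompat₁₃_top F N j γ ε₀ ε₂₉ B₃ B₃' a₀ a₁ p hK hj hw hγ hPC h3
  omega

/-- **`F.m < 2j` ⇒ ON EVERY WINDOWED FULL-LENGTH RUN WHERE THE ROW `h3` HOLDS AT LEVEL `K`, THE GUARD `PartCompat₁₃ … K` FAILS** (the other contrapositive). Count-neutral.
[cite: Balaban1988Convergent, (2.1) p.254, (2.5) p.255, (2.17) p.257; Balaban1987RG1, (0.1) p.251] -/
theorem not_partCompat₁₃_top_of_h3Row_of_lt (p : B12.RunParams) (hK : 1 ≤ p.K) (hj : 1 ≤ j) (hm : F.m < 2 * j) {γ' : ℝ}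
    (hw : Step.InInterval γ' p.K (gOfRecord₁₃ F N (theta13OfThm1CCMW F N j γ ε₀ ε₂₉ B₃ B₃' a₀ a₁) p)) (hγ : γ' < Real.exp (-(1 / 2)))
    (h3 : 3 * side (F.P p.K).L (theta13OfThm1CCMW F N j γ ε₀ ε₂₉ B₃ B₃' a₀ a₁).ν.M₁ p.K ≤
      cubeSide (F.P p.K).L (theta13OfThm1CCMW F N j γ ε₀ ε₂₉ B₃ B₃' a₀ a₁).ν.M₂
        (RkOfRecord (F.P p.K).L (theta13OfThm1CCMW F N j γ ε₀ ε₂₉ B₃ B₃' a₀ a₁).ν.r (gOfRecord₁₃ F N (theta13OfThm1CCMW F N j γ ε₀ ε₂₉ B₃ B₃' a₀ a₁) p p.K)) p.K) :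
    ¬ PartCompat₁₃ F N (theta13OfThm1CCMW F N j γ ε₀ ε₂₉ B₃ B₃' a₀ a₁) p p.K := fun hPC => by
  have := two_mul_le_m_of_h3Row_of_partCompat₁₃_top F N j γ ε₀ ε₂₉ B₃ B₃' a₀ a₁ p hK hj hw hγ hPC h3
  omega

end Witness

end Summit.QuantumFields.YangMills.Theorems.BalabanUVNodesN11TopLevelRoomAtThm1CCMW

end
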